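import Summits.ResolutionOfSingularities.ResolutionOfSingularities.Theorems.FrobeniusClosingSteerSingularTrace
import Summits.ResolutionOfSingularities.ResolutionOfSingularities.Theorems.FrobeniusClosingSteerSandwichModel
import Summits.ResolutionOfSingularities.ResolutionOfSingularities.Theorems.FrobeniusClosingSteerShannonCoarseningLemmas
import Summits.ResolutionOfSingularities.ResolutionOfSingularities.Theorems.FrobeniusClosingSteerMembersPerfectResidue
import Summits.ResolutionOfSingularities.ResolutionOfSingularities.Theorems.FrobeniusClosingSteerMonomialStageTrichotomy
import Summits.ResolutionOfSingularities.ResolutionOfSingularities.Theorems.FrobeniusClosingSteerCore4SteeredRunExists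
import Summits.ResolutionOfSingularities.ResolutionOfSingularities.Theorems.FrobeniusClosingSteerSwitchingAssembly
import HarnessLib

/-!
# Crux `Steer` (stmt-ResolutionOfSingularities-16345), line `switching_dichotomy`, card `singular-trace-constructor`:
# the CANONICAL SANDWICH over a regular member is never a regular model (corollary of `traceNotRegular_of_kunz`), and the
# characteristic-`p`-only form of the Kunz hypothesis (lane-A note N1 on p527625)

OURS (campaign `res-hironaka`, rung L ★L-G4, slot W4.1, chain W4.1; seat `res-type-083` g8, follow-up to res-L0-w41-plan-1's RULING 98
object p527625 `…FrobeniusClosingSteerSingularTrace` (res-L0-w41-strat-1 g5's card, «canonical singular upstairs models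
`S_M := {s | s ^ p ∈ R_M}`»); Theses-free, definition-free helper `--supports stmt-ResolutionOfSingularities-16345`; replaces the role of
no printed item; NOT a statement of the manuscript under review [claim: Hironaka2017, status: under-review]; AI-produced, weaker than
expert review).

* `exitAt_of_kunz` — THE ENGINE at ring level (res-L0-w41-strat-1's wish 11:48:57Z (2)): the hypotheses of `KunzKimuraNiitsumaDegP` for
  `R ≤ S ⊆ K` give `ExitAt R p t` for every `t ∈ S` («witness with regular trace ⇒ exit model», no `CoreDatum` / `NoExitModel'`).
* `exitAt_of_regular_trace` — THE ENGINE at model level (positive form of `TraceNotRegular`): under a core datum, a regular f.g. witness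
  `A ∋ t` whose trace model `A''` is regular at the centre gives `ExitAt (locAtCentre A'' O) p t`; six-step proof verbatim from p527625, with
  the Kunz hypothesis asked in characteristic `p` ONLY, `∀ K [Field K] [CharP K p], KunzKimuraNiitsumaDegP p K` (res-ref-a6's lane-A note
  N1: the `∀ K`-form of p527625 also quantifies over other characteristics, where the Prop is vacuous or, at p = 0, false).
* `traceNotRegular_of_kunz_of_charP` — `TraceNotRegular p` from the characteristic-`p` hypothesis (engine + `NoExitModel'`).
* `not_isRegularLocalRing_of_sandwich`: under a core datum and `NoExitModel'`, modulo the characteristic-`p` Kunz hypothesis: if a finitely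
generated model `A ⊇ A₀`, `t ∈ A`, is REGULAR at the centre of `O` and its centre ring is the FROBENIUS SANDWICH
`{x | x ^ p ∈ locAtCentre A'' O}` of the centre ring of a finitely generated model `A''` of the base field (`A₀ ≤ A'' ⊆ O ∩ Frac A₀`),
then `A''` is NOT regular at the centre — i.e. the integral closure in `K` of a REGULAR member of the base is never the centre ring of a
regular model («the canonical tower is singular»). Proof: over the assumed-regular (hence normal) `R := locAtCentre A'' O` the sandwich
clause yields the TRACE clause of `TraceNotRegular` (`Sandwich.mem_of_isIntegral_of_exists_div_of_isRegularLocalRing`,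
`Sandwich.isIntegral_of_pow_mem`), and `traceNotRegular_of_kunz_of_charP` concludes. [folklore]
-/

-- `Summit.<S>.<S>.…` duplicates the summit name by design (single-problem summit).
set_option linter.dupNamespace false

open IsLocalRing
open Literature.AlgebraicGeometry.Resolution
open Summit.ResolutionOfSingularities.ResolutionOfSingularities.Theorems.SteerRankThinness
open Summit.ResolutionOfSingularities.ResolutionOfSingularities.Theorems.SwitchingDichotomy.Words

namespace Summit.ResolutionOfSingularities.ResolutionOfSingularities.Theorems.SwitchingDichotomy

namespace SingularTrace

variable {k K : Type} [Field k] [Field K] [Algebra k K]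

/-! ## The composition with the characteristic-`p`-only Kunz hypothesis -/

/-- **THE ENGINE, ring level (unconditional in shape).** For regular local subrings `R ≤ S` of a field `K` satisfying the hypotheses
of `KunzKimuraNiitsumaDegP` — `S ^ p ⊆ R`, `S` finitely generated over `R`, equal residue fields, the degree clause, `S ≠ R` — the fact
hands a `z ∈ S` with `S ≤ R[z]` and `z ^ p` a regular parameter of `R`; so EVERY `t ∈ S` has an EXIT STAGE at `R`: `GenAt R p t z`
(`z ^ p ∈ R`, `t ∈ R[z]`) and `OrderOneGen R p z` (cleaner `g := 0`), i.e. `ExitAt R p t` («witness with regular trace ⇒ exit model»,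
res-L0-w41-strat-1's positive form). OURS. [folklore] -/
theorem exitAt_of_kunz {p : ℕ} (hp : p ≠ 0) (hKN : KunzKimuraNiitsumaDegP p K) {R S : Subring K} [IsLocalRing R] [IsLocalRing S]
    (hRS : R ≤ S) (hregR : IsRegularLocalRing R) (hregS : IsRegularLocalRing S) (hSp : ∀ s ∈ S, s ^ p ∈ R)
    (hFG : ∃ G : Finset K, (↑G : Set K) ⊆ S ∧ S ≤ Subring.closure ((R : Set K) ∪ ↑G))
    (hres : ∀ s ∈ S, ∃ r ∈ R, ∀ y ∈ S, (s - r) * y ≠ 1)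
    (hdeg : ∃ t₀ ∈ S, t₀ ^ p ∈ R ∧ ∀ s ∈ S, ∃ q : Polynomial K,
      (∀ i, ∃ a ∈ R, ∃ b ∈ R, b ≠ 0 ∧ q.coeff i = a / b) ∧ s = q.eval t₀)
    (hne : ∃ s ∈ S, s ∉ R) {t : K} (ht : t ∈ S) : ExitAt R p t := by
  obtain ⟨z, -, hzpR, hSle, w, hw, hwz⟩ := hKN R S hRS hregR hregS hSp hFG hres hdeg hne
  refine ⟨z, ⟨hzpR, hSle ht⟩, 0, Subring.zero_mem _, ‹IsLocalRing R›, w, hw, ?_⟩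
  rw [hwz, zero_pow hp, sub_zero]

/-- **THE ENGINE, model level: a regular witness with regular trace EXITS at the trace** (positive form of `TraceNotRegular`, with the
Kunz hypothesis in characteristic `p` only). Under a core datum: for a finitely generated model `A ∋ t` (inside `O`; `A₀ ≤ A` is not needed) regular at the centre of `O`
and `A'' ⊇ A₀` whose centre ring is the trace `locAtCentre A O ∩ Frac A₀`, if `A''` is regular at the centre then `ExitAt (locAtCentre A'' O) p t`.
Proof (res-L0-w41-strat-1 g5's six steps, verbatim from p527625): `S := locAtCentre A O`, `R := locAtCentre A'' O`; (1) `R ≤ S`, both local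
(`isLocalRing_locAtCentre`) and regular (`isRegularLocalRing_locAtCentre_iff`); (2) `S ^ p ⊆ R` (`Shannon.exists_pow_eq_div`); (3) finite
generation over `R` (`y / z = (y·z^{p-1})·(z^p)⁻¹`, `inv_mem_locAtCentre`); (4) equal residue fields through the valuation
(`MembersPerfectResidue.perfectField_residueField`, `MonomialStage.exists_isUnit_sub_pow_mem_maximalIdeal`, `sub_pow_char`); (5) degree
clause with `t₀ := t` (`exists_polynomial_of_mem_adjoin`); (6) `t ∉ R` (`SteeredRun.not_mem_closure_of_ne_pow`); then `exitAt_of_kunz`.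
OURS. [folklore] -/
theorem exitAt_of_regular_trace (p : ℕ) (hp : p.Prime)
    (hKN : ∀ (K : Type) [Field K] [CharP K p], KunzKimuraNiitsumaDegP p K)
    (n : ℕ) (k K : Type) [Field k] [CharP k p] [PerfectField k] [Field K] [Algebra k K]
    (O : ValuationSubring K) (A₀ : Subalgebra k K) (h₀ : A₀.toSubring ≤ O.toSubring) (t : K)
    (core : CoreDatum p n k K O A₀ h₀ t)
    (A : Subalgebra k K) (h : A.toSubring ≤ O.toSubring) (htA : t ∈ A) (hfgA : A.FG)
    (hregA : IsRegularLocalRing (Localization.AtPrime (Ideal.comap (Subring.inclusion h) (maximalIdeal O))))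
    (A'' : Subalgebra k K) (h'' : A''.toSubring ≤ O.toSubring) (hA₀A'' : A₀ ≤ A'')
    (htrace : ∀ x : K, x ∈ locAtCentre A''.toSubring O ↔ (x ∈ locAtCentre A.toSubring O ∧ IsFracOf A₀ x))
    (hregA'' : IsRegularLocalRing (Localization.AtPrime (Ideal.comap (Subring.inclusion h'') (maximalIdeal O)))) :
    ExitAt (locAtCentre A''.toSubring O) p t := by
  classical
  haveI : Fact p.Prime := ⟨hp⟩
  haveI : CharP K p := charP_of_injective_algebraMap (algebraMap k K).injective p
  obtain ⟨-, htp, hfr, hreg₀, -, hzd, -, -, -, -, -, hc, -, -⟩ := core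
  -- the two local rings `R ≤ S` inside `K`
  haveI instS : IsLocalRing (locAtCentre A.toSubring O) := isLocalRing_locAtCentre h
  haveI instR : IsLocalRing (locAtCentre A''.toSubring O) := isLocalRing_locAtCentre h''
  have hregS : IsRegularLocalRing (locAtCentre A.toSubring O) := (isRegularLocalRing_locAtCentre_iff h).mpr hregA
  have hregR : IsRegularLocalRing (locAtCentre A''.toSubring O) := (isRegularLocalRing_locAtCentre_iff h'').mpr hregA''
  have hSO : locAtCentre A.toSubring O ≤ O.toSubring := locAtCentre_le h
  have hRO : locAtCentre A''.toSubring O ≤ O.toSubring := locAtCentre_le h''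
  -- (1) `R ≤ S`
  have hRS : locAtCentre A''.toSubring O ≤ locAtCentre A.toSubring O := fun x hx => ((htrace x).mp hx).1
  -- `k ⊆ A₀ ⊆ R`
  have hA₀R : ∀ x ∈ A₀, x ∈ locAtCentre A''.toSubring O :=
    fun x hx => le_locAtCentre A''.toSubring O (hA₀A'' hx)
  have hkR : ∀ c : k, algebraMap k K c ∈ locAtCentre A''.toSubring O := fun c => hA₀R _ (A₀.algebraMap_mem c)
  -- (2) `S ^ p ⊆ R`
  have hSp : ∀ s ∈ locAtCentre A.toSubring O, s ^ p ∈ locAtCentre A''.toSubring O := fun s hs =>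
    (htrace (s ^ p)).mpr ⟨Subring.pow_mem _ hs p, Shannon.exists_pow_eq_div p A₀ t htp hfr s⟩
  -- (3) finite generation over `R`
  have hFG : ∃ G : Finset K, (↑G : Set K) ⊆ locAtCentre A.toSubring O ∧
      locAtCentre A.toSubring O ≤ Subring.closure ((locAtCentre A''.toSubring O : Set K) ∪ ↑G) := by
    obtain ⟨G, hG⟩ := hfgA
    refine ⟨G, fun x hx => le_locAtCentre A.toSubring O ?_, fun x hx => ?_⟩
    · change x ∈ A
      rw [← hG]
      exact Algebra.subset_adjoin hx
    · obtain ⟨y, hy, z, hz, hvz, rfl⟩ := hx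
      have hz0 : z ≠ 0 := ne_zero_of_valuation_eq_one hvz
      have hzS : z ∈ locAtCentre A.toSubring O := le_locAtCentre A.toSubring O hz
      have hzpR : z ^ p ∈ locAtCentre A''.toSubring O := hSp z hzS
      have hzpinv : (z ^ p)⁻¹ ∈ locAtCentre A''.toSubring O :=
        inv_mem_locAtCentre hzpR (by rw [map_pow, hvz, one_pow])
      have hyz : y * z ^ (p - 1) ∈ Subring.closure ((locAtCentre A''.toSubring O : Set K) ∪ ↑G) :=
        adjoin_le_closure_union hG _ hkR (A.mul_mem hy (A.pow_mem hz _))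
      have hrew : y / z = y * z ^ (p - 1) * (z ^ p)⁻¹ := by
        rw [pow_eq_pow_pred_mul hp.one_le z]
        field_simp
      rw [hrew]
      exact Subring.mul_mem _ hyz (Subring.subset_closure (Or.inl hzpinv))
  -- (4) equal residue fields
  haveI : PerfectField (ResidueField (locAtCentre A''.toSubring O)) :=
    MembersPerfectResidue.perfectField_residueField O (locAtCentre A''.toSubring O) hRO hkR hzd
  have hres : ∀ s ∈ locAtCentre A.toSubring O, ∃ r ∈ locAtCentre A''.toSubring O,
      ∀ y ∈ locAtCentre A.toSubring O, (s - r) * y ≠ 1 := by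
    intro s hs
    -- a non-unit is congruent to `0`; a unit has a unit `c ∈ R` with `v (s - c) < 1`
    have key : ∃ r ∈ locAtCentre A''.toSubring O, O.valuation (s - r) < 1 := by
      by_cases hvs : O.valuation s < 1
      · exact ⟨0, Subring.zero_mem _, by rwa [sub_zero]⟩
      have hvs1 : O.valuation s = 1 := le_antisymm ((O.valuation_le_one_iff _).mpr (hSO hs)) (not_lt.mp hvs)
      have hspR : s ^ p ∈ locAtCentre A''.toSubring O := hSp s hs
      have hu : IsUnit (⟨s ^ p, hspR⟩ : locAtCentre A''.toSubring O) := by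
        by_contra hnu
        have hlt : O.valuation (s ^ p) < 1 := (not_isUnit_locAtCentre_iff h'' ⟨s ^ p, hspR⟩).mp hnu
        rw [map_pow, hvs1, one_pow] at hlt
        exact lt_irrefl _ hlt
      obtain ⟨c, -, hc⟩ := MonomialStage.exists_isUnit_sub_pow_mem_maximalIdeal (S := locAtCentre A''.toSubring O) p hu
      have hlt : O.valuation (s ^ p - (c : K) ^ p) < 1 := by
        have h1 := (mem_maximalIdeal_locAtCentre_iff h'' _).mp hc
        simpa using h1
      rw [← sub_pow_char s (c : K), map_pow] at hlt
      refine ⟨(c : K), c.2, ?_⟩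
      by_contra hge
      exact absurd hlt (not_lt.mpr (one_le_pow₀ (not_lt.mp hge)))
    obtain ⟨r, hr, hvr⟩ := key
    refine ⟨r, hr, fun y hy hy1 => ?_⟩
    have hvy : O.valuation y ≤ 1 := (O.valuation_le_one_iff _).mpr (hSO hy)
    have hlt : O.valuation ((s - r) * y) < 1 := by
      rw [map_mul]
      calc O.valuation (s - r) * O.valuation y ≤ O.valuation (s - r) * 1 := by gcongr
        _ < 1 := by rw [mul_one]; exact hvr
    rw [hy1, map_one] at hlt
    exact lt_irrefl _ hlt
  -- (5) the degree clause with `t₀ := t`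
  have htS : t ∈ locAtCentre A.toSubring O := le_locAtCentre A.toSubring O htA
  have htpR : t ^ p ∈ locAtCentre A''.toSubring O := hA₀R _ htp
  have hdeg : ∃ t₀ ∈ locAtCentre A.toSubring O, t₀ ^ p ∈ locAtCentre A''.toSubring O ∧
      ∀ s ∈ locAtCentre A.toSubring O, ∃ q : Polynomial K,
        (∀ i, ∃ a ∈ locAtCentre A''.toSubring O, ∃ b ∈ locAtCentre A''.toSubring O, b ≠ 0 ∧ q.coeff i = a / b) ∧
        s = q.eval t₀ := by
    refine ⟨t, htS, htpR, fun s _ => ?_⟩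
    haveI := hfr
    obtain ⟨a, b, hb, rfl⟩ := IsFractionRing.div_surjective (A := Algebra.adjoin k (insert t (A₀ : Set K))) s
    have hb0 : (b : K) ≠ 0 := by
      have : (b : Algebra.adjoin k (insert t (A₀ : Set K))) ≠ 0 := nonZeroDivisors.ne_zero hb
      exact fun h => this (Subtype.ext h)
    have hab : (a : K) * (b : K) ^ (p - 1) ∈ Algebra.adjoin k (insert t (A₀ : Set K)) :=
      Subalgebra.mul_mem _ a.2 (Subalgebra.pow_mem _ b.2 _)
    obtain ⟨q, hq, hqt⟩ := exists_polynomial_of_mem_adjoin A₀ t hab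
    have hbp : (b : K) ^ p ∈ A₀ := Shannon.pow_mem_of_mem_adjoin_insert p A₀ htp b.2
    have hbp0 : (b : K) ^ p ≠ 0 := pow_ne_zero _ hb0
    refine ⟨Polynomial.C ((b : K) ^ p)⁻¹ * q, fun i => ⟨q.coeff i, hA₀R _ (hq i), (b : K) ^ p, hA₀R _ hbp, hbp0, ?_⟩, ?_⟩
    · rw [Polynomial.coeff_C_mul, div_eq_mul_inv, mul_comm]
    · change (a : K) / (b : K) = _
      rw [Polynomial.eval_mul, Polynomial.eval_C, hqt, pow_eq_pow_pred_mul hp.one_le (b : K)]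
      field_simp
  -- (6) `t ∈ S ∖ R`
  have hne : ∃ s ∈ locAtCentre A.toSubring O, s ∉ locAtCentre A''.toSubring O := by
    refine ⟨t, htS, fun htR => ?_⟩
    have hfrac : IsFracOf A₀ t := ((htrace t).mp htR).2
    exact SteeredRun.not_mem_closure_of_ne_pow O A₀ h₀ hp.ne_zero t htp hreg₀ hc
      ((exists_div_iff_mem_closure A₀ t).mp hfrac)
  -- the fact: a monogenic presentation `S = R[z]` with `z ^ p` a regular parameter of `R` — an EXIT at `R`
  exact exitAt_of_kunz hp.ne_zero (hKN K) hRS hregR hregS hSp hFG hres hdeg hne htS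

/-- **`TraceNotRegular` from the characteristic-`p` Kunz hypothesis**: the positive form `exitAt_of_regular_trace` contradicts
`NoExitModel'` at the trace model `A''`. (The landed `traceNotRegular_of_kunz`, p527625, assumes the fact for ALL fields; this form
asks it only in characteristic `p` — res-ref-a6's lane-A note N1.) OURS. [folklore] -/
theorem traceNotRegular_of_kunz_of_charP (p : ℕ) (hp : p.Prime)
    (hKN : ∀ (K : Type) [Field K] [CharP K p], KunzKimuraNiitsumaDegP p K) : TraceNotRegular p :=
  fun n k K _ _ _ _ _ O A₀ h₀ t core hneM A h _ htA hfgA hregA A'' h'' hA₀A'' hfgA'' htrace hregA'' =>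
    hneM A'' h'' hA₀A'' hfgA'' hregA''
      (exitAt_of_regular_trace p hp hKN n k K O A₀ h₀ t core A h htA hfgA hregA A'' h'' hA₀A'' htrace hregA'')


/-! ## Corollary: the canonical sandwich over a regular member is never a regular model -/

/-- **The canonical sandwich is singular.** Under a core datum and `NoExitModel'`: if `A` is a finitely generated model
(`A₀ ≤ A ∋ t`) REGULAR at the centre of `O`, and `A''` is a finitely generated model of the base field (`A₀ ≤ A'' ⊆ O ∩ Frac A₀`)
whose centre ring carries `A`'s as its FROBENIUS SANDWICH — `locAtCentre A O = {x | x ^ p ∈ locAtCentre A'' O}`, i.e. the local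
ring of `A` is the integral closure in `K` of that of `A''` — then `A''` is NOT regular at the centre. Equivalently: over a REGULAR
member `R_M` of the base, the canonical upstairs model `S_M := {s | s ^ p ∈ R_M}` (strat-1's «canonical singular tower») is never
the centre ring of a regular finitely generated model. Proof: for regular `R := locAtCentre A'' O` the sandwich clause gives the
TRACE clause of `TraceNotRegular` — `x ∈ R ⇒ x ∈ S ∧ x ∈ Frac A₀`; conversely `x ∈ S` with `x ∈ Frac A₀ = Frac R` has `x ^ p ∈ R`,
so `x` is integral over the normal ring `R` and a fraction of its elements, hence `x ∈ R`
(`Sandwich.mem_of_isIntegral_of_exists_div_of_isRegularLocalRing`) — and `traceNotRegular_of_kunz` applies. OURS. [folklore] -/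
theorem not_isRegularLocalRing_of_sandwich (p : ℕ) (hp : p.Prime)
    (hKN : ∀ (K : Type) [Field K] [CharP K p], KunzKimuraNiitsumaDegP p K)
    (n : ℕ) (k K : Type) [Field k] [CharP k p] [PerfectField k] [Field K] [Algebra k K]
    (O : ValuationSubring K) (A₀ : Subalgebra k K) (h₀ : A₀.toSubring ≤ O.toSubring) (t : K)
    (core : CoreDatum p n k K O A₀ h₀ t) (hneM : NoExitModel' p O A₀ t)
    (A : Subalgebra k K) (h : A.toSubring ≤ O.toSubring) (hA₀A : A₀ ≤ A) (htA : t ∈ A) (hfgA : A.FG)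
    (hregA : IsRegularLocalRing (Localization.AtPrime (Ideal.comap (Subring.inclusion h) (maximalIdeal O))))
    (A'' : Subalgebra k K) (h'' : A''.toSubring ≤ O.toSubring) (hA₀A'' : A₀ ≤ A'') (hfgA'' : A''.FG)
    (hfrac : ∀ x ∈ A'', IsFracOf A₀ x)
    (hsand : ∀ x : K, x ∈ locAtCentre A.toSubring O ↔ x ^ p ∈ locAtCentre A''.toSubring O) :
    ¬ IsRegularLocalRing (Localization.AtPrime (Ideal.comap (Subring.inclusion h'') (maximalIdeal O))) := by
  intro hregA''
  haveI : Fact p.Prime := ⟨hp⟩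
  haveI : CharP K p := charP_of_injective_algebraMap (algebraMap k K).injective p
  haveI : IsRegularLocalRing (locAtCentre A''.toSubring O) := (isRegularLocalRing_locAtCentre_iff h'').mpr hregA''
  obtain ⟨-, htp, hfr, -⟩ := id core
  -- every element of `R = locAtCentre A'' O` is a fraction of elements of `A₀`
  have hRfrac : ∀ x ∈ locAtCentre A''.toSubring O, IsFracOf A₀ x := by
    rintro _ ⟨y, hy, z, hz, hvz, rfl⟩
    obtain ⟨a, ha, b, hb, hb0, rfl⟩ := hfrac y hy
    obtain ⟨c, hc, d, hd, hd0, rfl⟩ := hfrac z hz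
    have hc0 : c ≠ 0 := by
      rintro rfl
      rw [zero_div, map_zero] at hvz
      exact zero_ne_one hvz
    exact ⟨a * d, A₀.mul_mem ha hd, b * c, A₀.mul_mem hb hc, mul_ne_zero hb0 hc0, by field_simp⟩
  refine traceNotRegular_of_kunz_of_charP p hp hKN n k K O A₀ h₀ t core hneM A h hA₀A htA hfgA hregA A'' h'' hA₀A'' hfgA''
    (fun x => ⟨fun hx => ?_, fun hx => ?_⟩) hregA''
  · -- `x ∈ R ⇒ x ^ p ∈ R ⇒ x ∈ S`, and `x ∈ Frac A₀`
    exact ⟨(hsand x).mpr (Subring.pow_mem _ hx p), hRfrac x hx⟩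
  · -- `x ∈ S ∩ Frac A₀`: `x ^ p ∈ R`, `x` integral over the normal ring `R` and a fraction of its elements
    obtain ⟨hxS, a, ha, b, hb, hb0, rfl⟩ := hx
    have hR : ∀ y ∈ A₀, y ∈ locAtCentre A''.toSubring O := fun y hy => le_locAtCentre A''.toSubring O (hA₀A'' hy)
    exact Sandwich.mem_of_isIntegral_of_exists_div_of_isRegularLocalRing (locAtCentre A''.toSubring O)
      (Sandwich.isIntegral_of_pow_mem p (locAtCentre A''.toSubring O) ((hsand _).mp hxS))
      ⟨a, hR a ha, b, hR b hb, hb0, rfl⟩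

end SingularTrace

end Summit.ResolutionOfSingularities.ResolutionOfSingularities.Theorems.SwitchingDichotomy
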